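/-
Copyright (c) 2026 the pub-hodgecm-mathlib formalisation cell (harness21).  Prover seat hodgecm-mathlib-LH7-p07 (g0), Track A «(D-RAM) FOUR-FRAME» squad, helper lane on
h413 = stmt-HodgeConjecture-24833 (count-neutral).  β-BOARD v1 (sub-dealer LH4-p05 (g8)) row R7 «GLUE CLASSES» support: the tower-sign token at ARBITRARY precision.  2026-09-04.
-/
import Summits.HodgeConjecture.HodgeConjecture.Theorems.F0P3cDyRamTowerSignToken                -- ★ p860771∕p860907: `exists_towerSign_of_le` (precision `m*`), `mstarOfRecord`, datum letters
import Literature.NumberTheory.LocalFields.WildQuadraticDatumTrace                       -- ★ `exists_v_le_add_map_eq` (the trace hits `𝔭_F` deep enough)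
import Literature.NumberTheory.LocalFields.WildQuadraticDatumRefSkewScalar               -- ★ `v_refSkewScalar`, `map_refSkewScalar_eq_neg`, `refSkewScalar_ne_zero` (the reference skew scalar `t₊`)
import HarnessLib

/-!
# Crux `H413`, line LH4 «(D-RAM) FOUR-FRAME» — THE TOWER-SIGN TOKEN AT ARBITRARY PRECISION: for `α ∈ E¹` of depth `n ≡ ℓ₀ (mod 2)` and every `N` with
# `ℓ₀ < N` and `N + d ≤ n + ℓ₀ + 1` there is a `σ`-fixed unit `e` with `(α − 1)·π^{−(n−ℓ₀)∕2} ≡ e·t₊ (mod ϖ^N)` — the GLUED strata need `N = m* + 2ρ − (n − ℓ₀) > m*`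

Cell `hodgecm-mathlib` (D-0151), FLOOR 0, crux item H413 = `stmt-HodgeConjecture-24833`, route `HCCMUnconditional`; squad F0∕P3c∕LH4 (β-BOARD v1, row R7 «glue classes»,
mechanism note `F0/P3c/LH7/LH7-p07/g0/r7model/R7-GLUE-MECHANISM.v1.LH7p07g0.md` §1).  THEOREMS ONLY (no `def`, no instance, no notation, no `sorry`, default heartbeats); ★-only
imports; lane `--supports stmt-HodgeConjecture-24833 --as helper`; pays NO row, states NO law.

THE MATHEMATICS ([Serre1979, Ch. V §3]; ★ `WildQuadraticDatumTrace`).  Notation as in ★ `F0P3cDyRamTowerSignToken`: `π := ϖ·σϖ`, `ℓ₀ := d % 2`, `t₊ := (ϖ − σϖ)·π^{−(d−ℓ₀)∕2}`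
(skew, `|t₊| = |ϖ|^{ℓ₀}`), `z := (α − 1)·π^{−(n−ℓ₀)∕2}` (`|z| = |ϖ|^{ℓ₀}`, almost skew: `z + σz = z·(α−1)∕α` is `σ`-fixed of valuation `|ϖ|^{n+ℓ₀}`).  ★ `exists_v_le_add_map_eq`
produces `x` with `x + σx = z + σz` and `|x| ≤ |ϖ|^N` for EVERY `N` with `N + d ≤ n + ℓ₀ + 1` (the trace maps `𝔭_E^N` onto `𝔭_F^{⌊(N+d)∕2⌋}`); then `e := (z − x)∕t₊` is `σ`-fixed,
a unit as soon as `N > ℓ₀`, and `z − e·t₊ = x`.  ★ p860771 is the instance `N = m* = ℓ₀ + 2d − 1`; the GLUED strata `(2ρ, 2ρ+s, 2ρ+s)` with `2ρ > n` read the value-class label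
through ★ `valueClassLabel_glued_rep_class_iff_normSign`, whose hypothesis `hgα` asks for the token of `(α−1)` at absolute precision `ϖ^{m*+2ρ}`, i.e. `N = m* + 2ρ − (n − ℓ₀)`;
the best `N` allowed here, `n + ℓ₀ + 1 − d`, meets it iff `2ρ ≤ 2n − mcOfRecord d` — exactly the CLEAN range of the glue column (the `X²`-token at level `mcOfRecord d`).
* §1 `exists_towerSign_prec` — the token at precision `N` (`d % 2 < N`, `N + d ≤ n + d % 2 + 1`), ★ p860771's statement with `mstarOfRecord d ↦ N`.
* §2 `exists_towerSign_prec_abs` — the same in ABSOLUTE form: `∃ g` `σ`-fixed, `|g| = |ϖ|^{n−ℓ₀}`, `g = e·π^{(n−ℓ₀)∕2}` with `e` a fixed unit, and `|(α − 1) − g·t₊| ≤ |ϖ|^{N + (n − ℓ₀)}`;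
  `exists_towerSign_prec_abs_of_le` — the instance `N = n + ℓ₀ + 1 − d` (the optimal one), for `mstarOfRecord d + d ≤ n + ℓ₀ + 1`.
HONEST LABEL.  Count-neutral arithmetic helper; R7∕table∕(β-BAL)∕(β)∕T₊ row OPEN; `HC_CM` is proved only modulo the 7 printed citations (2 remaining named inputs: hLiu418 =
`stmt-HodgeConjecture-24832`, h413 = `stmt-HodgeConjecture-24833`) until rung 0 closes.

## References
* [Serre1979] J.-P. Serre, *Local Fields*, GTM 67 (1979), Ch. V §3 (trace and different of a ramified quadratic extension: `Tr 𝔭_E^N = 𝔭_F^{⌊(N+d)∕2⌋}`).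
* [Rogawski1990] J. D. Rogawski, *Automorphic Representations of Unitary Groups in Three Variables*, Ann. of Math. Stud. 123 (1990), §4.9 p. 55 (the `E¹`-elements near `1`).
-/

set_option autoImplicit false

noncomputable section

namespace Summit.HodgeConjecture.HodgeConjecture.Cruxes.H413.F0P3cDyRamTowerSignTokenSharp

open Literature.NumberTheory.Automorphic Literature.NumberTheory.Automorphic.UnitaryThreeFourFrame
open Literature.NumberTheory.LocalFields Literature.NumberTheory.LocalFields.WildQuadraticDatum
open Summit.HodgeConjecture.HodgeConjecture.Cruxes.H413.F0P3cDyRamFourFramePieces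
open Summit.HodgeConjecture.HodgeConjecture.Cruxes.H413.F0P3cDyRamStageOneBDefs
open WithZero
open scoped Valued

variable {K : Type} [Field K] [Valued K ℤᵐ⁰]

/-! ## §1  The token at precision `N` -/

/-- **THE TOWER-SIGN TOKEN AT PRECISION `N`.**  At a ramified datum, for `α·σα = 1` with `|α − 1| = |ϖ|^n`, `n ≡ d % 2 (mod 2)`, and a precision `N` with `d % 2 < N` and
`N + d ≤ n + d % 2 + 1`: there is a `σ`-fixed unit `e` with `|(ϖ^N)⁻¹·((α − 1)·((ϖσϖ)^{(n − d%2)∕2})⁻¹ − e·t₊)| ≤ 1`, `t₊ = (ϖ − σϖ)·((ϖσϖ)^{(d − d%2)∕2})⁻¹`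
(★ p860771 `exists_towerSign_of_le` is `N = mstarOfRecord d`). [cite: Serre1979, Ch. V §3] [cite: Rogawski1990, §4.9 p. 55] -/
theorem exists_towerSign_prec {σ : K →+* K} {ϖ : K} {d t : ℕ} (hD : IsRamifiedQuadraticDatum σ ϖ d t)
    {α : K} (hα : α * σ α = 1) {n : ℕ} (hvα : Valued.v (α - 1) = Valued.v ϖ ^ n) (hpar : n % 2 = d % 2)
    {N : ℕ} (hN0 : d % 2 < N) (hN : N + d ≤ n + d % 2 + 1) :
    ∃ e : K, σ e = e ∧ Valued.v e = 1 ∧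
      Valued.v ((ϖ ^ N)⁻¹ * ((α - 1) * ((ϖ * σ ϖ) ^ ((n - d % 2) / 2))⁻¹ - e * ((ϖ - σ ϖ) * ((ϖ * σ ϖ) ^ ((d - d % 2) / 2))⁻¹))) ≤ 1 := by
  obtain ⟨hσ, hvσ, hϖ, hfix, hd, h1d, ht⟩ := hD
  -- `n = 2k + ℓ₀`
  obtain ⟨k, hnk⟩ : ∃ k : ℕ, n = 2 * k + d % 2 := ⟨n / 2, by omega⟩
  have hk : (n - d % 2) / 2 = k := by omega
  rw [hk]
  -- notation and basic valuations
  set π : K := ϖ * σ ϖ with hπdef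
  set tp : K := (ϖ - σ ϖ) * ((ϖ * σ ϖ) ^ ((d - d % 2) / 2))⁻¹ with htpdef
  set z : K := (α - 1) * (π ^ k)⁻¹ with hzdef
  have hϖ0 : ϖ ≠ 0 := fun h => by rw [h, map_zero] at hϖ; exact (coe_ne_zero hϖ.symm).elim
  have hvϖ0 : Valued.v ϖ ≠ 0 := (Valuation.ne_zero_iff _).2 hϖ0
  have hσϖ0 : σ ϖ ≠ 0 := (map_ne_zero σ).2 hϖ0
  have hπ0 : π ≠ 0 := mul_ne_zero hϖ0 hσϖ0
  have hσπ : σ π = π := by rw [hπdef, map_mul, hσ, mul_comm]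
  have hvπ : Valued.v π = Valued.v ϖ ^ 2 := by rw [hπdef, map_mul, hvσ, pow_two]
  have hα0 : α ≠ 0 := fun h => by rw [h, zero_mul] at hα; exact zero_ne_one hα
  have hvαu : Valued.v α = 1 := by
    have h2 : Valued.v α * Valued.v α = 1 := by nth_rw 2 [← hvσ α]; rw [← map_mul, hα, map_one]
    rw [← pow_two] at h2
    exact ((pow_eq_one_iff).1 h2).resolve_right two_ne_zero
  have hσα : σ α = α⁻¹ := eq_inv_of_mul_eq_one_right hα
  -- `|z| = |ϖ|^{ℓ₀}`
  have hvz : Valued.v z = Valued.v ϖ ^ (d % 2) := by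
    have h1 : Valued.v (π ^ k) = Valued.v ϖ ^ (2 * k) := by rw [map_pow, hvπ, ← pow_mul]
    rw [hzdef, map_mul, map_inv₀, h1, hvα, hnk, pow_add, mul_assoc, mul_comm (Valued.v ϖ ^ (d % 2)), ← mul_assoc,
      mul_inv_cancel₀ (pow_ne_zero _ hvϖ0), one_mul]
  -- the trace of `z` is `σ`-fixed of valuation `|ϖ|^{n + ℓ₀}`
  have hσz : σ z = -(z * α⁻¹) := by
    rw [hzdef, map_mul, map_inv₀, map_pow, hσπ, map_sub, map_one, hσα]
    field_simp
    ring
  have htr : z + σ z = z * ((α - 1) * α⁻¹) := by rw [hσz]; field_simp; ring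
  have hσtr : σ (z + σ z) = z + σ z := by rw [map_add, hσ, add_comm]
  have hvtr : Valued.v (z + σ z) ≤ exp (-(2 * ((k + d % 2 : ℕ) : ℤ))) := by
    rw [htr, map_mul, hvz, map_mul, map_inv₀, hvαu, hvα, inv_one, mul_one, ← pow_add, v_varpi_pow hϖ]
    apply le_of_eq
    congr 1
    push_cast
    omega
  -- the trace is onto deep enough: `x` with `|x| ≤ |ϖ|^N` and `x + σx = z + σz`
  have hjm : (N : ℤ) + d ≤ 2 * ((k + d % 2 : ℕ) : ℤ) + 1 := by push_cast; omega
  obtain ⟨x, hvx, hx⟩ := exists_v_le_add_map_eq hσ hfix hϖ hd ht hσtr hvtr hjm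
  -- `z' := z − x` is skew; `e := z' ∕ t₊`
  have htp0 : tp ≠ 0 := refSkewScalar_ne_zero hvσ hϖ hd
  have hσtp : σ tp = -tp := map_refSkewScalar_eq_neg hσ _
  have hvtp : Valued.v tp = Valued.v ϖ ^ (d % 2) := by rw [htpdef, v_refSkewScalar hvσ hϖ hd, v_varpi_pow hϖ]
  have hskew : σ (z - x) = -(z - x) := by
    have h1 : σ x = z + σ z - x := by rw [← hx]; ring
    rw [map_sub, h1]; ring
  have hlt : Valued.v x < Valued.v z := by
    rw [hvz, v_varpi_pow hϖ]
    refine lt_of_le_of_lt hvx ?_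
    rw [exp_lt_exp]
    omega
  refine ⟨(z - x) * tp⁻¹, ?_, ?_, ?_⟩
  · rw [map_mul, map_inv₀, hskew, hσtp, neg_mul, inv_neg, mul_neg, neg_neg]
  · rw [map_mul, map_inv₀, Valuation.map_sub_eq_of_lt_left _ hlt, hvz, hvtp, mul_inv_cancel₀ (pow_ne_zero _ hvϖ0)]
  · -- `z − e·t₊ = x`
    have hcalc : (α - 1) * ((ϖ * σ ϖ) ^ k)⁻¹ - (z - x) * tp⁻¹ * ((ϖ - σ ϖ) * ((ϖ * σ ϖ) ^ ((d - d % 2) / 2))⁻¹) = x := by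
      rw [← htpdef, mul_assoc, inv_mul_cancel₀ htp0, mul_one]
      show z - (z - x) = x
      ring
    rw [hcalc, map_mul, map_inv₀, map_pow, v_varpi_pow hϖ, ← exp_neg, neg_neg]
    calc exp ((N : ℕ) : ℤ) * Valued.v x ≤ exp ((N : ℕ) : ℤ) * exp (-(N : ℤ)) := by gcongr
      _ = 1 := by rw [← exp_add, ← exp_zero]; congr 1; simp

/-! ## §2  The absolute form -/

/-- **THE TOKEN AT PRECISION `N`, ABSOLUTE FORM.**  Same hypotheses: there are a `σ`-fixed unit `e` and the `σ`-fixed `g := e·(ϖσϖ)^{(n − d%2)∕2}` (`|g| = |ϖ|^{n − d%2}`) with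
`|(α − 1) − g·t₊| ≤ |ϖ|^{N + (n − d%2)}` — the shape of the `hgα`∕`hgβ` letters of ★ `valueClassLabel_glued_rep_class_iff_normSign` once multiplied by the polarisation size.
[cite: Serre1979, Ch. V §3] [cite: Rogawski1990, §4.9 p. 55] -/
theorem exists_towerSign_prec_abs {σ : K →+* K} {ϖ : K} {d t : ℕ} (hD : IsRamifiedQuadraticDatum σ ϖ d t)
    {α : K} (hα : α * σ α = 1) {n : ℕ} (hvα : Valued.v (α - 1) = Valued.v ϖ ^ n) (hpar : n % 2 = d % 2)
    {N : ℕ} (hN0 : d % 2 < N) (hN : N + d ≤ n + d % 2 + 1) :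
    ∃ e g : K, σ e = e ∧ Valued.v e = 1 ∧ σ g = g ∧ g = e * (ϖ * σ ϖ) ^ ((n - d % 2) / 2) ∧ Valued.v g = Valued.v ϖ ^ (n - d % 2) ∧
      Valued.v ((α - 1) - g * ((ϖ - σ ϖ) * ((ϖ * σ ϖ) ^ ((d - d % 2) / 2))⁻¹)) ≤ Valued.v ϖ ^ (N + (n - d % 2)) := by
  obtain ⟨hσ, hvσ, hϖ, -, -, -, -⟩ := id hD
  obtain ⟨e, hσe, hve, hbound⟩ := exists_towerSign_prec hD hα hvα hpar hN0 hN
  have hϖ0 : ϖ ≠ 0 := fun h => by rw [h, map_zero] at hϖ; exact (coe_ne_zero hϖ.symm).elim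
  have hvϖ0 : Valued.v ϖ ≠ 0 := (Valuation.ne_zero_iff _).2 hϖ0
  have hσϖ0 : σ ϖ ≠ 0 := (map_ne_zero σ).2 hϖ0
  set k : ℕ := (n - d % 2) / 2 with hkdef
  have h2k : 2 * k = n - d % 2 := by omega
  set P : K := (ϖ * σ ϖ) ^ k with hPdef
  have hP0 : P ≠ 0 := pow_ne_zero _ (mul_ne_zero hϖ0 hσϖ0)
  have hσP : σ P = P := by rw [hPdef, map_pow, map_mul, hσ, mul_comm]
  have hvP : Valued.v P = Valued.v ϖ ^ (n - d % 2) := by rw [hPdef, map_pow, map_mul, hvσ, ← pow_two, ← pow_mul, h2k]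
  refine ⟨e, e * P, hσe, hve, by rw [map_mul, hσe, hσP], rfl, by rw [map_mul, hve, one_mul, hvP], ?_⟩
  -- `(α−1) − (eP)·t₊ = P·((α−1)P⁻¹ − e·t₊)` and `|(ϖ^N)⁻¹·(…)| ≤ 1`
  set tp : K := (ϖ - σ ϖ) * ((ϖ * σ ϖ) ^ ((d - d % 2) / 2))⁻¹ with htpdef
  have hfac : (α - 1) - e * P * tp = P * ((α - 1) * P⁻¹ - e * tp) := by field_simp
  have hNv : Valued.v ((α - 1) * P⁻¹ - e * tp) ≤ Valued.v ϖ ^ N := by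
    have h0 : Valued.v ((ϖ ^ N)⁻¹) ≠ 0 := (Valuation.ne_zero_iff _).2 (inv_ne_zero (pow_ne_zero _ hϖ0))
    have h1 : Valued.v ((ϖ ^ N)⁻¹) * Valued.v ((α - 1) * P⁻¹ - e * tp) ≤ Valued.v ((ϖ ^ N)⁻¹) * Valued.v ϖ ^ N := by
      rw [← map_mul, map_inv₀, map_pow, inv_mul_cancel₀ (pow_ne_zero _ hvϖ0)]
      have := hbound
      rwa [map_mul, map_inv₀, map_pow] at this
    exact le_of_mul_le_mul_left h1 ((Valuation.pos_iff _).2 (inv_ne_zero (pow_ne_zero _ hϖ0)))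
  rw [hfac, map_mul, hvP, pow_add, mul_comm (Valued.v ϖ ^ N)]
  gcongr

/-- `mstarOfRecord d + d ≤ n + d % 2 + 1` makes the OPTIMAL precision `N = n + d % 2 + 1 − d` admissible (`d % 2 < N`). [cite: Rogawski1990, §4.9 p. 55] -/
theorem mod_two_lt_optimal_of_le {d n : ℕ} (h : mstarOfRecord d + d ≤ n + d % 2 + 1) : d % 2 < n + d % 2 + 1 - d := by
  unfold mstarOfRecord at h
  omega

/-- **THE TOKEN AT THE OPTIMAL PRECISION `N = n + ℓ₀ + 1 − d`** (absolute form), under ★ p860771's bound `mstarOfRecord d + d ≤ n + d % 2 + 1` (so in the whole derived regime,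
★ `mstarOfRecord_add_le_of_mcOfRecord_le`): `|(α − 1) − g·t₊| ≤ |ϖ|^{(n + d%2 + 1 − d) + (n − d%2)}`.  For the glued strata this is the letter «`(α−1) ≡ g_α t₊ (mod ϖ^{m*+2ρ})` whenever
`2ρ ≤ 2n − mcOfRecord d`». [cite: Serre1979, Ch. V §3] [cite: Rogawski1990, §4.9 p. 55] -/
theorem exists_towerSign_prec_abs_of_le {σ : K →+* K} {ϖ : K} {d t : ℕ} (hD : IsRamifiedQuadraticDatum σ ϖ d t)
    {α : K} (hα : α * σ α = 1) {n : ℕ} (hvα : Valued.v (α - 1) = Valued.v ϖ ^ n) (hpar : n % 2 = d % 2)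
    (hn : mstarOfRecord d + d ≤ n + d % 2 + 1) :
    ∃ e g : K, σ e = e ∧ Valued.v e = 1 ∧ σ g = g ∧ g = e * (ϖ * σ ϖ) ^ ((n - d % 2) / 2) ∧ Valued.v g = Valued.v ϖ ^ (n - d % 2) ∧
      Valued.v ((α - 1) - g * ((ϖ - σ ϖ) * ((ϖ * σ ϖ) ^ ((d - d % 2) / 2))⁻¹)) ≤ Valued.v ϖ ^ ((n + d % 2 + 1 - d) + (n - d % 2)) :=
  exists_towerSign_prec_abs hD hα hvα hpar (mod_two_lt_optimal_of_le hn) (by unfold mstarOfRecord at hn; omega)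

end Summit.HodgeConjecture.HodgeConjecture.Cruxes.H413.F0P3cDyRamTowerSignTokenSharp

end
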